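import Summits.QuantumFields.YangMills.Theses.SandwichVariancePinching

/-!
# Route `SandwichVariancePinching` — support `SandwichMoments` (stmt-QuantumFields-28262's sibling, stmt-QuantumFields-28261)
# is FALSE AS FILED at the edge `δ = 1`: REFUTATION, class «misstated», with the one-token repair

`SandwichMoments` asks, for EVERY `δ ∈ [0, 1]` (closed interval), every `n`, every positive definite `H₀` and every continuous `A`
whose second differences are pinched between `(1 − δ)·hᵀH₀h` and `(1 + δ)·hᵀH₀h`, that `e^{−A}` be Lebesgue-integrable on `ℝⁿ` (and
more).  At `δ = 1` the lower pinching is VOID (`0 ≤ A(x+h) + A(x−h) − 2A(x)`), so `A` is merely midpoint-convex and need not be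
coercive: the WITNESS `n = 1`, `H₀ = 1`, `A ≡ 0`, `δ = 1` satisfies every hypothesis (`0 ≤ 0 ≤ 2h²`) while `e^{−A} ≡ 1` is not
integrable on `ℝ¹` (Lebesgue measure is infinite).  Hence `¬ SandwichMoments`.

CLASS: refuted-MISSTATED (degenerate edge of a side condition), not substantive.  REPAIRED STATEMENT C′ (believed true, and all the
route's `closes` needs since the cruxes produce their own `δ₀` which may be taken `< 1`): replace `δ ≤ 1` by `δ < 1` —
`∀ δ, 0 ≤ δ → δ < 1 → ∀ n H₀ A, H₀.PosDef → Continuous A → (sandwich) → Integrable e^{−A} ∧ 0 < ∫ e^{−A} ∧ ∀ H H' b b', …`;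
then `(1 − δ)·H₀ ≻ 0` makes `A − (1−δ)/2·xᵀH₀x` convex and continuous, hence bounded below by an affine function, and Gaussian
domination gives every moment.  The witness misses C′ (it needs `δ = 1` exactly).  Equivalently the planner may keep `δ ≤ 1` here and
cap `δ₀ < 1` in `closes` (`min δ₁ δ₂ (1/2)`).

HONEST SCOPE.  Refutes one support item as typed; says nothing against the line (ceiling/floor cruxes, target crux
`LogConcaveChart.QuadraticCovarianceComparison`), rung R2a or any summit statement; nothing here bears on the Yang–Mills mass gap.
-/

namespace Summit.QuantumFields.YangMills.Theorems

open MeasureTheory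

/-- Lebesgue measure on `ℝ¹ = (Fin 1 → ℝ)` is not finite. [folklore] -/
theorem SandwichVariancePinching.not_isFiniteMeasure_volume_fin_one :
    ¬ IsFiniteMeasure (volume : Measure (Fin 1 → ℝ)) := by
  intro h
  have h1 : (volume : Measure (Fin 1 → ℝ)) Set.univ = ⊤ := by
    rw [volume_pi, Measure.pi_univ]
    simp
  exact (measure_lt_top (volume : Measure (Fin 1 → ℝ)) Set.univ).ne h1

/-- **`SandwichMoments` (stmt-QuantumFields-28261) IS FALSE AS FILED — refuted-misstated.**  Witness: `δ = 1`, `n = 1`, `H₀ = 1`,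
`A ≡ 0`.  The sandwich hypothesis reads `0·h² ≤ 0 ≤ 2·h²` (true), `A` is continuous, `H₀ = 1` is positive definite, yet the first
conclusion `Integrable (fun x => exp (−A x))` is integrability of the constant `1` over `ℝ¹`, which fails (infinite Lebesgue measure).
REPAIRED C′: demand `δ < 1` (strict) — then `(1−δ)H₀ ≻ 0` restores coercivity and the item holds; the witness needs `δ = 1` and
misses C′.  [folklore] -/
theorem not_SandwichMoments :
    ¬ Summit.QuantumFields.YangMills.Theses.SandwichVariancePinching.SandwichMoments := by
  intro h
  have hsw : ∀ x v : Fin 1 → ℝ,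
      (1 - (1 : ℝ)) * (v ⬝ᵥ (1 : Matrix (Fin 1) (Fin 1) ℝ).mulVec v) ≤
          (fun _ : Fin 1 → ℝ => (0 : ℝ)) (x + v) + (fun _ : Fin 1 → ℝ => (0 : ℝ)) (x - v) -
            2 * (fun _ : Fin 1 → ℝ => (0 : ℝ)) x ∧
        (fun _ : Fin 1 → ℝ => (0 : ℝ)) (x + v) + (fun _ : Fin 1 → ℝ => (0 : ℝ)) (x - v) -
            2 * (fun _ : Fin 1 → ℝ => (0 : ℝ)) x ≤
          (1 + (1 : ℝ)) * (v ⬝ᵥ (1 : Matrix (Fin 1) (Fin 1) ℝ).mulVec v) := by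
    intro x v
    refine ⟨by simp, ?_⟩
    have hv : 0 ≤ v ⬝ᵥ v := Finset.sum_nonneg fun i _ => mul_self_nonneg (v i)
    simp only [Matrix.one_mulVec, add_zero, sub_zero, mul_zero]
    linarith
  obtain ⟨hint, -, -⟩ := h 1 zero_le_one le_rfl 1 (1 : Matrix (Fin 1) (Fin 1) ℝ) (fun _ => 0)
    Matrix.PosDef.one continuous_const hsw
  have hint' : Integrable (fun _ : Fin 1 → ℝ => (1 : ℝ)) (volume : Measure (Fin 1 → ℝ)) := by
    refine hint.congr (Filter.Eventually.of_forall fun x => ?_)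
    simp
  exact SandwichVariancePinching.not_isFiniteMeasure_volume_fin_one
    ((integrable_const_iff_isFiniteMeasure one_ne_zero).mp hint')

end Summit.QuantumFields.YangMills.Theorems
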